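import Summits.QuantumFields.BalabanUV.Beta.GAN24.Lin4SlotDivergence
import Summits.QuantumFields.BalabanUV.Beta.WardLocusQuarticTable
import Literature.MathematicalPhysics.QuantumFieldTheory.Balaban1983to89.Beta.BalabanStepW2

/-!
# `BalabanUV.Beta.GAN24.CombPinLockScalar` — binder row G-an2-4 ∕ (CONV-C), W-slot EXIT (α), located gap G1 «the scalar rows at the literal»:
# **D1's LOCK AT THE COMB PIN FORCES THE LOCK CONSTANTS `cH l = (stepScale d Lc l · Lc^{d+1})⁻¹` (d1-leaf-07's `c_H`), AND THEN THE PRODUCT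
# `q_l = (sf_l·sm_l)⁻¹·(cH l)⁻¹` IS THE LEVEL-FREE NUMBER `Lc^{d+1}`** — the three scalar displays `hcH0 ∕ hcH ∕ hq` of the letter-level D1 literal discharged
# (road-P2 chair of row G-an2-4, unit `b2b-balaban-gan24-p2` gen 46, crux team (2))

NOT IN PRINT; OUR BOOKKEEPING ([folklore] scalar algebra; 0 `def`, 0 cited facts, 0 `def … : Prop`, 0 sorry).  HONEST FRAMING (cell contract, verbatim): «discharging
`BetaPertH` makes Bałaban's UV stability UNCONDITIONAL — a real constructive-QFT result; it is NOT the continuum limit and NOT the Clay problem.»  HONEST DEPENDENCY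
(verbatim): «continuum YM on T⁴ ⇐ BetaPertH ∧ nine spine estimates (0/9 proved); BetaPertH ⇐ (D1) ∧ (D4) ∧ CAP+tail; G-an2-4 gates asym, D1 and NE2/3/4.»

WHAT (scalars only: road P1's units `sfStep Lc l = Lc^l`, `smStep d Lc l = Lc^{l(d+1)}` (`GAN24/CombesThomas`); the border scale `stepScale d Lc l = (Lc^l)^{d+2}`
(`BorderedHessianStep`; `sfStep·smStep = stepScale` is leaf-06's `Lin4SlotDivergence.sfStep_mul_smStep`, imported); an2's weights `wE d Lc l = (Lc^l)^{3(d+2)}`, `wV4 d Lc l = (Lc^l)^{4(d+2)}`; the comb pin `cE₂ = Lc^{2(d+1)}` of D1's literal (`= Lc^8` at `d = 3`);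
the PINNED LOCK CONSTANT is written out everywhere as the term `(stepScale d Lc l * Lc^{d+1})⁻¹` — the `cH` of d1-leaf-07's `KernelWardHColumnWall.colH_ward_KInvStep_all`, no new name):
* §1 `lock_pin` — D1's lock row `hlock : cH′·(cE₂·wV4 (j+1))·½ = (Lc^{d+1}·wE (j+1))·½` (`WardLocusQuarticTable.tableLaw_T2RecAt_succ`) HOLDS at the pin with
  `cH′ := (stepScale d Lc (j+1) * Lc^{d+1})⁻¹` (= d1-leaf-06's `lock_succ_of_pin` at `hcE₂ := rfl`, REUSED by name); **`lock_pin_iff`** (NEW) — and ONLY with it: at `cE₂ = Lc^{2(d+1)}` the lock row is EQUIVALENT to `cH′ = (stepScale d Lc (j+1) * Lc^{d+1})⁻¹`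
  (so pinning the lock constants is not a choice but what D1's own hypothesis says); `lockScalar_zero` — at level `0` the same term is `(Lc^{d+1})⁻¹`, the contact constant of
  the unit comb kernel (leaf-06's `E3SlotDivergence` §4, d1-leaf-07's level-`0` case `stepScale 0 = 1`).
* §2 `lockScalar_ne_zero` (the display `hcH0`); **`unitScalar_mul_lockScalar_inv`**: `(sfStep Lc l * smStep d Lc l)⁻¹ * ((stepScale d Lc l * Lc^{d+1})⁻¹)⁻¹ = Lc^{d+1}` for EVERY `l` —
  the product the S-step letter rows carry is level-free; hence **`hq_pin`** (the display `hq` of MY `BlockCommutatorStepLetterDrift.exists_evenRowsDrift_uniform_three`, an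
  equality of two level-free numbers) and **`hcH_pin`** (the display `hcH` of MY `BlockCommutatorStepLetter.exists_evenRows_uniform_three` with `c₀ := Lc^{d+1}`), both in their
  binder shapes; `_three` forms at `d = 3` with the literal's spelling `Lc^8` of the pin.
READING: at leaf-01 g73's letter-level D1 literal `WrecAtEvenHalfRowsOfWardLetters.exists_allScalesSeq_JsRowD1Pin_of_wardLetters` the binders `hcH0 hcH hq` are met by §2 once
`cH := fun l ↦ (stepScale 3 Lc l * Lc^{3+1})⁻¹`, and §1 says that D1's table-law supplier (`tableLaw_T2RecAt_succ` under `hlock` at `cE₂ = Lc^8`) can deliver `hTL ∕ hTL″` for no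
other `cH (l+1)`.  Scalar algebra only; asserts NOTHING about Bałaban's tables; discharges NOTHING of (Q-L) ∕ (C) ∕ D1's Ward data ∕ «T2Shape^{ev}» ∕ «T2Drift^{ev}» ∕ (hW, hWall);
NEVER «G-an2-4 closed» as (CONV-C); NOT D1, NOT `BetaPertH`, NOT continuum, NOT Clay; not in print — our bookkeeping.  2026-08-23.
-/

noncomputable section

open Literature.MathematicalPhysics.QuantumFieldTheory.Balaban1983to89.Beta
open BalabanStepJetsSucc (wE)
open BalabanStepW2 (wV4)
open Summit.QuantumFields.BalabanUV.Beta.BorderedHessian (stepScale stepScale_ne_zero stepScale_pos)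
open Summit.QuantumFields.BalabanUV.Beta.GAN24.CombesThomas (sfStep smStep sfStep_ne_zero smStep_ne_zero)
open Summit.QuantumFields.BalabanUV.Beta.GAN24.Lin4SlotDivergence (sfStep_mul_smStep)
open Summit.QuantumFields.BalabanUV.Beta.WardLocusQuarticTable (lock_succ_of_pin)

namespace Summit.QuantumFields.BalabanUV.Beta.GAN24.CombPinLockScalar

variable {d : ℕ} {Lc : ℕ} [NeZero Lc]

/-- [folklore] `(Lc : ℝ) ≠ 0`. -/
private theorem cast_ne_zero : (Lc : ℝ) ≠ 0 := Nat.cast_ne_zero.2 (NeZero.ne Lc)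

/-- [folklore] `0 < (Lc : ℝ)`. -/
private theorem cast_pos : (0 : ℝ) < Lc := Nat.cast_pos.2 (Nat.pos_of_ne_zero (NeZero.ne Lc))

/-! ## §1 D1's lock row at the comb pin: it holds with, and only with, the pinned lock constant -/

omit [NeZero Lc] in
/-- [folklore] `stepScale d Lc l = Lc^{l(d+2)}` as a single power of `Lc`. -/
theorem stepScale_eq_pow (l : ℕ) : stepScale d Lc l = (Lc : ℝ) ^ (l * (d + 2)) := by
  unfold stepScale; rw [← pow_mul]

omit [NeZero Lc] in
/-- [folklore] `wV4 d Lc l = Lc^{4l(d+2)}` as a single power. -/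
theorem wV4_eq_pow (l : ℕ) : wV4 d Lc l = (Lc : ℝ) ^ (l * (4 * (d + 2))) := by
  unfold wV4; rw [← pow_mul]

/-- [folklore] **D1's LOCK ROW HOLDS AT THE COMB PIN WITH THE PINNED LOCK CONSTANT** — this IS d1-leaf-06's `WardLocusQuarticTable.lock_succ_of_pin` at `hcE₂ := rfl`
(REUSED, one term; restated only to have the pin as a literal and no `1 ≤ Lc` binder): `cH′·(Lc^{2(d+1)}·wV4 (j+1))·½ = (Lc^{d+1}·wE (j+1))·½` with
`cH′ := (stepScale d Lc (j+1) * Lc^{d+1})⁻¹` — the binder `hlock` of `WardLocusQuarticTable.tableLaw_T2RecAt_succ`. -/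
theorem lock_pin (j : ℕ) :
    (stepScale d Lc (j + 1) * (Lc : ℝ) ^ (d + 1))⁻¹ * ((Lc : ℝ) ^ (2 * (d + 1)) * wV4 d Lc (j + 1)) * ((1 : ℝ) / 2)
      = ((Lc : ℝ) ^ (d + 1) * wE d Lc (j + 1)) * ((1 : ℝ) / 2) :=
  lock_succ_of_pin (d := d) (Nat.one_le_iff_ne_zero.2 (NeZero.ne Lc)) rfl j

/-- NOT IN PRINT; OUR BOOKKEEPING.  **… AND ONLY WITH IT**: at the comb pin `cE₂ = Lc^{2(d+1)}` D1's lock row is EQUIVALENT to `cH′ = (stepScale d Lc (j+1) * Lc^{d+1})⁻¹` —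
the lock constants of the letter-level literal are not a choice of ours but what D1's displayed hypothesis `hlock` says. -/
theorem lock_pin_iff (j : ℕ) {cH' : ℝ} :
    cH' * ((Lc : ℝ) ^ (2 * (d + 1)) * wV4 d Lc (j + 1)) * ((1 : ℝ) / 2) = ((Lc : ℝ) ^ (d + 1) * wE d Lc (j + 1)) * ((1 : ℝ) / 2)
      ↔ cH' = (stepScale d Lc (j + 1) * (Lc : ℝ) ^ (d + 1))⁻¹ := by
  constructor
  · intro h
    have hne : ((Lc : ℝ) ^ (2 * (d + 1)) * wV4 d Lc (j + 1)) * ((1 : ℝ) / 2) ≠ 0 :=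
      mul_ne_zero (mul_ne_zero (pow_ne_zero _ cast_ne_zero) (by rw [wV4_eq_pow]; exact pow_ne_zero _ cast_ne_zero)) (by norm_num)
    have lp := lock_pin (d := d) (Lc := Lc) j
    rw [mul_assoc] at h lp
    exact mul_right_cancel₀ hne (h.trans lp.symm)
  · rintro rfl; exact lock_pin j

omit [NeZero Lc] in
/-- [folklore] At level `0` the pinned lock constant is `(Lc^{d+1})⁻¹` — the contact constant of the unit comb kernel (`stepScale d Lc 0 = 1`). -/
theorem lockScalar_zero : (stepScale d Lc 0 * (Lc : ℝ) ^ (d + 1))⁻¹ = ((Lc : ℝ) ^ (d + 1))⁻¹ := by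
  rw [stepScale_eq_pow, Nat.zero_mul, pow_zero, one_mul]

/-! ## §2 The pinned lock constants: non-zero, and the letters' scalar `(sf_l·sm_l)⁻¹·(cH l)⁻¹` is the level-free number `Lc^{d+1}` -/

/-- [folklore] The pinned lock constant is non-zero (the display `hcH0` of the letter-level literal). -/
theorem lockScalar_ne_zero (l : ℕ) : (stepScale d Lc l * (Lc : ℝ) ^ (d + 1))⁻¹ ≠ 0 :=
  inv_ne_zero (mul_ne_zero (stepScale_ne_zero l) (pow_ne_zero _ cast_ne_zero))

/-- NOT IN PRINT; OUR BOOKKEEPING.  **THE LETTERS' SCALAR IS LEVEL-FREE**: `(sfStep Lc l * smStep d Lc l)⁻¹ * ((stepScale d Lc l * Lc^{d+1})⁻¹)⁻¹ = Lc^{d+1}` for every `l`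
(the units' product IS the border scale, which cancels against the lock constant's). -/
theorem unitScalar_mul_lockScalar_inv (l : ℕ) :
    (sfStep Lc l * smStep d Lc l)⁻¹ * ((stepScale d Lc l * (Lc : ℝ) ^ (d + 1))⁻¹)⁻¹ = (Lc : ℝ) ^ (d + 1) := by
  rw [inv_inv, sfStep_mul_smStep, ← mul_assoc, inv_mul_cancel₀ (stepScale_ne_zero l), one_mul]

/-- NOT IN PRINT; OUR BOOKKEEPING.  **THE DISPLAY `hq` AT THE PIN** (binder shape of MY `BlockCommutatorStepLetterDrift.exists_evenRowsDrift_uniform_of_rows ∕ _three` with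
`cH := fun l ↦ (stepScale d Lc l * Lc^{d+1})⁻¹`): the scalar at level `l+1` equals the scalar at level `l` — both are `Lc^{d+1}`. -/
theorem hq_pin (l : ℕ) :
    (sfStep Lc (l + 1) * smStep d Lc (l + 1))⁻¹ * ((stepScale d Lc (l + 1) * (Lc : ℝ) ^ (d + 1))⁻¹)⁻¹
      = (sfStep Lc l * smStep d Lc l)⁻¹ * ((stepScale d Lc l * (Lc : ℝ) ^ (d + 1))⁻¹)⁻¹ := by
  rw [unitScalar_mul_lockScalar_inv, unitScalar_mul_lockScalar_inv]

/-- NOT IN PRINT; OUR BOOKKEEPING.  **THE DISPLAY `hcH` AT THE PIN** (binder shape of MY `BlockCommutatorStepLetter.exists_evenRows_uniform_of_rows ∕ _three` with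
`cH := fun l ↦ (stepScale d Lc l * Lc^{d+1})⁻¹`, `c₀ := Lc^{d+1}`): `|(sf_l·sm_l)⁻¹·(cH l)⁻¹| ≤ Lc^{d+1}` (with equality). -/
theorem hcH_pin (l : ℕ) :
    |(sfStep Lc l * smStep d Lc l)⁻¹ * ((stepScale d Lc l * (Lc : ℝ) ^ (d + 1))⁻¹)⁻¹| ≤ (Lc : ℝ) ^ (d + 1) := by
  rw [unitScalar_mul_lockScalar_inv, abs_of_nonneg (pow_nonneg cast_pos.le _)]

/-! ## §3 The `d = 3` spellings of the letter-level literal (`cE₂ = Lc^8`, `cE = Lc^4 = Lc^{3+1}`) -/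

/-- NOT IN PRINT; OUR BOOKKEEPING.  `d = 3`: D1's lock row at the literal's pin `cE₂ = Lc^8` with the pinned lock constant `(stepScale 3 Lc (j+1) * Lc^{3+1})⁻¹`. -/
theorem lock_pin_three (j : ℕ) :
    (stepScale 3 Lc (j + 1) * (Lc : ℝ) ^ (3 + 1))⁻¹ * ((Lc : ℝ) ^ 8 * wV4 3 Lc (j + 1)) * ((1 : ℝ) / 2)
      = ((Lc : ℝ) ^ (3 + 1) * wE 3 Lc (j + 1)) * ((1 : ℝ) / 2) := by
  simpa only [show 2 * (3 + 1) = 8 from rfl] using lock_pin (d := 3) (Lc := Lc) j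

/-- NOT IN PRINT; OUR BOOKKEEPING.  `d = 3`: at the literal's pin `cE₂ = Lc^8` D1's lock row is EQUIVALENT to `cH′ = (stepScale 3 Lc (j+1) * Lc^{3+1})⁻¹`. -/
theorem lock_pin_iff_three (j : ℕ) {cH' : ℝ} :
    cH' * ((Lc : ℝ) ^ 8 * wV4 3 Lc (j + 1)) * ((1 : ℝ) / 2) = ((Lc : ℝ) ^ (3 + 1) * wE 3 Lc (j + 1)) * ((1 : ℝ) / 2)
      ↔ cH' = (stepScale 3 Lc (j + 1) * (Lc : ℝ) ^ (3 + 1))⁻¹ := by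
  simpa only [show 2 * (3 + 1) = 8 from rfl] using lock_pin_iff (d := 3) (Lc := Lc) j (cH' := cH')

/-- NOT IN PRINT; OUR BOOKKEEPING.  `d = 3`: the display `hcH0` of `WrecAtEvenHalfRowsOfWardLetters.exists_allScalesSeq_JsRowD1Pin_of_wardLetters` at the pinned lock constants. -/
theorem hcH0_pin_three : ∀ l : ℕ, (stepScale 3 Lc l * (Lc : ℝ) ^ (3 + 1))⁻¹ ≠ 0 := fun l => lockScalar_ne_zero (d := 3) l

/-- NOT IN PRINT; OUR BOOKKEEPING.  `d = 3`: the display `hcH` of the letter-level literal at the pinned lock constants, `c₀ := Lc^{3+1}`. -/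
theorem hcH_pin_three : ∀ l : ℕ, |(sfStep Lc l * smStep 3 Lc l)⁻¹ * ((stepScale 3 Lc l * (Lc : ℝ) ^ (3 + 1))⁻¹)⁻¹| ≤ (Lc : ℝ) ^ (3 + 1) :=
  fun l => hcH_pin (d := 3) l

/-- NOT IN PRINT; OUR BOOKKEEPING.  `d = 3`: the display `hq` of the letter-level literal at the pinned lock constants. -/
theorem hq_pin_three : ∀ l : ℕ, (sfStep Lc (l + 1) * smStep 3 Lc (l + 1))⁻¹ * ((stepScale 3 Lc (l + 1) * (Lc : ℝ) ^ (3 + 1))⁻¹)⁻¹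
    = (sfStep Lc l * smStep 3 Lc l)⁻¹ * ((stepScale 3 Lc l * (Lc : ℝ) ^ (3 + 1))⁻¹)⁻¹ := fun l => hq_pin (d := 3) l

end Summit.QuantumFields.BalabanUV.Beta.GAN24.CombPinLockScalar

end
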